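import Mathlib
import HarnessLib
import Summits.NavierStokesRegularity.NavierStokesRegularity.Theorems.StretchingWellBindingEnstrophyQuarterLawSparsenessCoarse
import Summits.NavierStokesRegularity.NavierStokesRegularity.Theorems.StretchingWellBindingEnstrophyQuarterLawSparsenessEarly
import Summits.NavierStokesRegularity.NavierStokesRegularity.Theorems.StretchingWellBindingEnstrophyQuarterLawFarFieldEnstrophy
import Summits.NavierStokesRegularity.NavierStokesRegularity.Theorems.StretchingWellBindingEnstrophyQuarterLawSparsenessTools

/-!
# Shelf 1574, line `sparse_sieve`: uniform sparseness is UNCONDITIONAL at macroscopic scales —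
# what remains OPEN of stub S2 is exactly the regime `r → 0`, `t → T`

Helper file (`--supports stmt-NavierStokesRegularity-1574 --as helper`; route-independent imports). The registered
stub S2 `stub_uniformSparseness` of `Cruxes/EnstrophyQuarterLaw/Lines/sparse_sieve.lean` asks, for every first
blow-up, for ONE bound `N₀(ε₀)` on `4r`-separated `ε₀`-concentrating families at ALL scales `0 < r ≤ r₀`. Two of the
three regimes of its no-loss certificate need no window law at all:

* `sparse_at_scales_ge` — **for EVERY first blow-up** (maximal classical solution, Leray–Hopf from a rapidly
  decaying datum; NO quarter law, NO Type-I hypothesis) and every band of scales `0 < r_min ≤ r₀`: for every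
  `ε₀ > 0` there is `N₀` bounding every `4r`-separated `ε₀`-concentrating family at every `t ∈ [0, T)` and every
  `r ∈ [r_min, r₀]` (early times `t ≤ T/2`: `SparsenessEarly.sparse_early_of_lerayHopf`; late times: the landed
  far-field enstrophy bound `SparseSieve.stub_farFieldEnstrophy` (Tao 2013 Thm 10.1) feeds
  `SparsenessCoarse.sparse_coarse_of_farField` — volume packing near the origin, exterior `L³` bound far away);
* `sparse_at_scale` — the one-scale form (`r_min = r₀ = r`).

So a violation of S2 ("a satellite swarm") can only consist of concentrating balls whose radii tend to `0` as
`t → T` — S2 is a genuinely SMALL-SCALE statement, like S1 (CKN `A`, `E` are trivially bounded at scales `≥ r_min`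
by the energy). HONEST FRAMING: a-priori bookkeeping about one hypothetical blow-up; S2 itself (all scales at
once) and `EnstrophyQuarterLaw` (1574) stay OPEN; nothing here bears on the regularity problem. No summit
statement is proved.
-/

noncomputable section

-- the summit-side namespace repeats a component by design (D-0017)
set_option linter.dupNamespace false

namespace Summit.NavierStokesRegularity.NavierStokesRegularity.Theorems.EnstrophyQuarterLaw.SparsenessMacroscopic

open Set MeasureTheory Function Metric Filter Topology
open scoped ENNReal NNReal
open Literature.Analysis.FluidPDE

variable {ν T : ℝ} {u : ℝ → EuclideanSpace ℝ (Fin 3) → EuclideanSpace ℝ (Fin 3)}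
  {p : ℝ → EuclideanSpace ℝ (Fin 3) → ℝ}

/-- **Uniform sparseness at macroscopic scales, unconditionally.** For every maximal classical solution on
`[0, T)` (`ν, T > 0`), Leray–Hopf from a rapidly decaying datum, and every band of scales `0 < r_min ≤ r₀`: for
every `ε₀ > 0` there is `N₀ ∈ ℕ` such that for all `t ∈ [0, T)`, all `r ∈ [r_min, r₀]` and every finite
`4r`-separated family `F` of centres with `∫_{B(x, 2r)} |u(t)|³ ≥ ε₀³` (`x ∈ F`), `card F ≤ N₀`. (Early times by
the sup bound on `[0, T/2]`; late times by the far-field enstrophy bound + packing + exterior `L³`.) [folklore] -/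
theorem sparse_at_scales_ge (hν : 0 < ν) (hT : 0 < T) (hmax : IsMaximalSmoothSolution ν 0 u p T)
    (hLH : IsLerayHopfOn T ν 0 (u 0) u) (hdec : HasRapidSpatialDecay (u 0))
    {rmin r₀ : ℝ} (hrmin : 0 < rmin) (hr₀ : rmin ≤ r₀) :
    ∀ ε₀ : ℝ, 0 < ε₀ → ∃ N₀ : ℕ, ∀ t ∈ Ico 0 T, ∀ r ∈ Icc rmin r₀,
      ∀ F : Finset (EuclideanSpace ℝ (Fin 3)),
        (∀ x ∈ F, ∀ y ∈ F, x ≠ y → 4 * r ≤ dist x y) →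
        (∀ x ∈ F, ENNReal.ofReal (ε₀ ^ 3) ≤ ∫⁻ y in ball x (2 * r), ‖u t y‖ₑ ^ 3) →
        F.card ≤ N₀ := by
  intro ε₀ hε₀
  obtain ⟨ρ, B, hB, hFF⟩ := SparseSieve.stub_farFieldEnstrophy ν T hν hT u p hmax hLH hdec
  obtain ⟨N₁, h₁⟩ := SparsenessEarly.sparse_early_of_lerayHopf hν hmax.1 hLH hdec (T' := T / 2)
    ⟨by positivity, by linarith⟩ ε₀ hε₀
  obtain ⟨N₂, h₂⟩ := SparsenessCoarse.sparse_coarse_of_farField hν hmax.1 hLH hB hFF hrmin hr₀ ε₀ hε₀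
  refine ⟨N₁ + N₂, fun t ht r hr F hsep hconc => ?_⟩
  rcases le_or_gt t (T / 2) with hle | hgt
  · have h := h₁ t ⟨ht.1, hle⟩ r (hrmin.trans_le hr.1) F hsep hconc
    omega
  · have h := h₂ t ⟨hgt.le, ht.2⟩ r hr F hsep hconc
    omega

/-- **Uniform sparseness at one fixed scale, unconditionally**: for every maximal classical Leray–Hopf solution
from a rapidly decaying datum, every `r > 0` and `ε₀ > 0` there is `N₀` bounding, at every `t ∈ [0, T)`, every
`4r`-separated family of centres whose `2r`-balls carry `∫ |u(t)|³ ≥ ε₀³`. [folklore] -/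
theorem sparse_at_scale (hν : 0 < ν) (hT : 0 < T) (hmax : IsMaximalSmoothSolution ν 0 u p T)
    (hLH : IsLerayHopfOn T ν 0 (u 0) u) (hdec : HasRapidSpatialDecay (u 0)) {r : ℝ} (hr : 0 < r) :
    ∀ ε₀ : ℝ, 0 < ε₀ → ∃ N₀ : ℕ, ∀ t ∈ Ico 0 T, ∀ F : Finset (EuclideanSpace ℝ (Fin 3)),
        (∀ x ∈ F, ∀ y ∈ F, x ≠ y → 4 * r ≤ dist x y) →
        (∀ x ∈ F, ENNReal.ofReal (ε₀ ^ 3) ≤ ∫⁻ y in ball x (2 * r), ‖u t y‖ₑ ^ 3) →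
        F.card ≤ N₀ := by
  intro ε₀ hε₀
  obtain ⟨N₀, h⟩ := sparse_at_scales_ge hν hT hmax hLH hdec hr le_rfl ε₀ hε₀
  exact ⟨N₀, fun t ht F hsep hconc => h t ht r ⟨le_rfl, le_rfl⟩ F hsep hconc⟩

/-! ### APPENDED (same hand): no upper cap on the scale — one bound for ALL scales `r ≥ r_min` -/

/-- **Late times, all scales `r ≥ r_min`, one bound.** For a classical solution on `[0, T)` (`ν > 0`), Leray–Hopf on
`[0, T]`, whose enstrophy outside `B(0, ρ)` stays `≤ B` on `[T/2, T)`, and `r_min > 0`: for every `ε₀ > 0` there is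
`N₀` such that for all `t ∈ [T/2, T)`, ALL `r ≥ r_min` and every finite `4r`-separated family `F` of centres with
`∫_{B(x, 2r)} |u(t)|³ ≥ ε₀³`, `card F ≤ N₀` — the near-field packing bound `(ρ₁/(2r) + 2)³` only improves as `r`
grows (`SparsenessCoarse.sparse_coarse_of_farField` with the radius of the near field tied to `r`). [folklore] -/
theorem sparse_late_of_scale_ge (hν : 0 < ν)
    (hsol : IsClassicalNSSolutionOn (Ico 0 T) ν 0 u p) (hLH : IsLerayHopfOn T ν 0 (u 0) u)
    {ρ B : ℝ} (hB : 0 ≤ B)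
    (hFF : ∀ t ∈ Ico (T / 2) T,
      ∫⁻ x in (ball (0 : EuclideanSpace ℝ (Fin 3)) ρ)ᶜ, ‖curl (u t) x‖ₑ ^ 2 ≤ ENNReal.ofReal B)
    {rmin : ℝ} (hrmin : 0 < rmin) :
    ∀ ε₀ : ℝ, 0 < ε₀ → ∃ N₀ : ℕ, ∀ t ∈ Ico (T / 2) T, ∀ r : ℝ, rmin ≤ r →
      ∀ F : Finset (EuclideanSpace ℝ (Fin 3)),
        (∀ x ∈ F, ∀ y ∈ F, x ≠ y → 4 * r ≤ dist x y) →
        (∀ x ∈ F, ENNReal.ofReal (ε₀ ^ 3) ≤ ∫⁻ y in ball x (2 * r), ‖u t y‖ₑ ^ 3) →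
        F.card ≤ N₀ := by
  classical
  intro ε₀ hε₀
  obtain ⟨ρ₁, C₃, hρ₁, hC₃, hfar⟩ := SparsenessCoarse.farField_norm_cube_le hν hsol hLH hB hFF
  set Nn : ℕ := ⌊(ρ₁ / (2 * rmin) + 2) ^ 3⌋₊ with hNn
  set Nf : ℕ := ⌊8 * C₃ / ε₀ ^ 3⌋₊ with hNf
  refine ⟨Nn + Nf, fun t ht r hr F hsep hconc => ?_⟩
  have hrpos : 0 < r := hrmin.trans_le hr
  have htI : t ∈ Ico 0 T := ⟨by linarith [ht.1, ht.2], ht.2⟩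
  -- ### near field: volume packing in `B(0, ρ₁ + 2r)`
  set P : EuclideanSpace ℝ (Fin 3) → Prop := fun x => (0 : EuclideanSpace ℝ (Fin 3)) ∈ ball x (ρ₁ + 2 * r)
    with hP
  have hnear : ((F.filter P).card : ℝ) ≤ (ρ₁ / (2 * rmin) + 2) ^ 3 := by
    have h := SparsenessTools.card_filter_mem_ball_le_of_separated (s := 4 * r) (ρ := ρ₁ + 2 * r)
      (by positivity) (by positivity) F hsep 0
    refine h.trans (pow_le_pow_left₀ (by positivity) ?_ 3)
    have e : (ρ₁ + 2 * r + 4 * r / 2) / (4 * r / 2) = ρ₁ / (2 * r) + 2 := by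
      field_simp
      ring
    rw [e]
    have h2 : ρ₁ / (2 * r) ≤ ρ₁ / (2 * rmin) :=
      div_le_div_of_nonneg_left hρ₁.le (by positivity) (by linarith)
    linarith
  have hnearN : (F.filter P).card ≤ Nn := Nat.le_floor (by exact_mod_cast hnear)
  -- ### far field: the balls of the remaining centres lie outside `B(0, ρ₁)`
  set S : Set (EuclideanSpace ℝ (Fin 3)) := (ball (0 : EuclideanSpace ℝ (Fin 3)) ρ₁)ᶜ with hS
  have hSm : MeasurableSet S := measurableSet_ball.compl
  have hballS : ∀ x ∈ F.filter (fun x => ¬ P x), ball x (2 * r) ⊆ S := by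
    intro x hx y hy
    have hx' : ¬ (0 : EuclideanSpace ℝ (Fin 3)) ∈ ball x (ρ₁ + 2 * r) := (Finset.mem_filter.1 hx).2
    rw [mem_ball, dist_comm, dist_zero_right, not_lt] at hx'
    rw [hS, mem_compl_iff, mem_ball, dist_zero_right, not_lt]
    rw [mem_ball] at hy
    have h1 : ‖x‖ ≤ ‖y‖ + dist y x := by
      have := norm_le_norm_add_norm_sub' x y
      rw [← dist_eq_norm, dist_comm] at this
      exact this
    linarith
  set g : EuclideanSpace ℝ (Fin 3) → ℝ≥0∞ := S.indicator fun y => ‖u t y‖ₑ ^ 3 with hg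
  have hcont : Continuous (u t) := (hsol.contDiff_velocity htI).continuous
  have hgm : AEMeasurable g volume :=
    ((hcont.measurable.enorm.pow_const _).indicator hSm).aemeasurable
  have hsepf : ∀ x ∈ F.filter (fun x => ¬ P x), ∀ y ∈ F.filter (fun x => ¬ P x), x ≠ y →
      4 * r ≤ dist x y := fun x hx y hy hxy =>
    hsep x (Finset.mem_filter.1 hx).1 y (Finset.mem_filter.1 hy).1 hxy
  have hsum := SparsenessTools.sum_setLIntegral_ball_le_of_separated (s := 4 * r) (ρ := 2 * r)
    (by positivity) (by positivity) (F.filter (fun x => ¬ P x)) hsepf hgm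
  have e8 : ((2 * r + 4 * r / 2) / (4 * r / 2)) ^ 3 = (8 : ℝ) := by
    field_simp
    ring
  rw [e8] at hsum
  have hgint : ∫⁻ y, g y ≤ ENNReal.ofReal C₃ := by
    rw [hg, lintegral_indicator hSm]
    exact hfar t ht
  have hcard : ((F.filter (fun x => ¬ P x)).card : ℝ≥0∞) * ENNReal.ofReal (ε₀ ^ 3) ≤
      ENNReal.ofReal (8 * C₃) := by
    calc ((F.filter (fun x => ¬ P x)).card : ℝ≥0∞) * ENNReal.ofReal (ε₀ ^ 3)
        = ∑ x ∈ F.filter (fun x => ¬ P x), ENNReal.ofReal (ε₀ ^ 3) := by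
          rw [Finset.sum_const, nsmul_eq_mul]
      _ ≤ ∑ x ∈ F.filter (fun x => ¬ P x), ∫⁻ y in ball x (2 * r), g y := by
          refine Finset.sum_le_sum fun x hx => (hconc x (Finset.mem_filter.1 hx).1).trans (le_of_eq ?_)
          rw [hg, ← lintegral_indicator measurableSet_ball, ← lintegral_indicator measurableSet_ball]
          refine lintegral_congr fun y => ?_
          by_cases hy : y ∈ ball x (2 * r)
          · rw [indicator_of_mem hy, indicator_of_mem hy, indicator_of_mem (hballS x hx hy)]
          · rw [indicator_of_notMem hy, indicator_of_notMem hy]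
      _ ≤ ENNReal.ofReal 8 * ∫⁻ y, g y := hsum
      _ ≤ ENNReal.ofReal 8 * ENNReal.ofReal C₃ := mul_le_mul' le_rfl hgint
      _ = ENNReal.ofReal (8 * C₃) := by rw [← ENNReal.ofReal_mul (by norm_num)]
  have hreal : ((F.filter (fun x => ¬ P x)).card : ℝ) * ε₀ ^ 3 ≤ 8 * C₃ := by
    have h1 := ENNReal.toReal_mono ENNReal.ofReal_ne_top hcard
    rwa [ENNReal.toReal_mul, ENNReal.toReal_natCast, ENNReal.toReal_ofReal (by positivity),
      ENNReal.toReal_ofReal (by positivity)] at h1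
  have hfarN : (F.filter (fun x => ¬ P x)).card ≤ Nf := by
    refine Nat.le_floor ?_
    rw [le_div_iff₀ (by positivity)]
    exact hreal
  have htot := Finset.card_filter_add_card_filter_not (s := F) P
  omega

/-- **Uniform sparseness at ALL scales bounded below, one bound, unconditionally.** For every maximal classical
solution on `[0, T)` (`ν, T > 0`), Leray–Hopf from a rapidly decaying datum, and every `r_min > 0`: for every
`ε₀ > 0` there is `N₀ ∈ ℕ` such that for all `t ∈ [0, T)`, ALL `r ≥ r_min` and every finite `4r`-separated family
`F` of centres with `∫_{B(x, 2r)} |u(t)|³ ≥ ε₀³` (`x ∈ F`), `card F ≤ N₀`. So along any violation of S2 the radii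
of the concentrating balls must tend to `0`. [folklore] -/
theorem sparse_of_scale_ge (hν : 0 < ν) (hT : 0 < T) (hmax : IsMaximalSmoothSolution ν 0 u p T)
    (hLH : IsLerayHopfOn T ν 0 (u 0) u) (hdec : HasRapidSpatialDecay (u 0)) {rmin : ℝ} (hrmin : 0 < rmin) :
    ∀ ε₀ : ℝ, 0 < ε₀ → ∃ N₀ : ℕ, ∀ t ∈ Ico 0 T, ∀ r : ℝ, rmin ≤ r →
      ∀ F : Finset (EuclideanSpace ℝ (Fin 3)),
        (∀ x ∈ F, ∀ y ∈ F, x ≠ y → 4 * r ≤ dist x y) →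
        (∀ x ∈ F, ENNReal.ofReal (ε₀ ^ 3) ≤ ∫⁻ y in ball x (2 * r), ‖u t y‖ₑ ^ 3) →
        F.card ≤ N₀ := by
  intro ε₀ hε₀
  obtain ⟨ρ, B, hB, hFF⟩ := SparseSieve.stub_farFieldEnstrophy ν T hν hT u p hmax hLH hdec
  obtain ⟨N₁, h₁⟩ := SparsenessEarly.sparse_early_of_lerayHopf hν hmax.1 hLH hdec (T' := T / 2)
    ⟨by positivity, by linarith⟩ ε₀ hε₀
  obtain ⟨N₂, h₂⟩ := sparse_late_of_scale_ge hν hmax.1 hLH hB hFF hrmin ε₀ hε₀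
  refine ⟨N₁ + N₂, fun t ht r hr F hsep hconc => ?_⟩
  rcases le_or_gt t (T / 2) with hle | hgt
  · have h := h₁ t ⟨ht.1, hle⟩ r (hrmin.trans_le hr) F hsep hconc
    omega
  · have h := h₂ t ⟨hgt.le, ht.2⟩ r hr F hsep hconc
    omega

end Summit.NavierStokesRegularity.NavierStokesRegularity.Theorems.EnstrophyQuarterLaw.SparsenessMacroscopic

end
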